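import Summits.NavierStokesRegularity.NavierStokesRegularity.Theorems.EfficiencyFloorRigidExitReferenceShadowingRobustness
import Summits.NavierStokesRegularity.NavierStokesRegularity.Theorems.EfficiencyFloorRigidExitReferenceShadowingRate
import HarnessLib

/-!
# Route `EfficiencyFloor`, support `RigidExit` (stmt-NavierStokesRegularity-25513) on the `ProductionEfficiencyDecay` ladder
# (stmt-NavierStokesRegularity-22866): UNIFORM `H¹` SHADOWING OF THE REFERENCE FLOW ON WINDOWS `[δ, τ] ⊂ (0, τ₁]`

Helper file (`--supports stmt-NavierStokesRegularity-22866`; line `efficiency_floor`). Items 2+3 of the (R-shadow) census of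
`RigidExit` (hand g24) ASSEMBLED: the windowed robustness estimate with the printed slicewise-Agmon rate
(`ReferenceShadowing.robustness_window_of_le`, p840201) run with REFERENCE = Leray's flow `v` through an admissible `m` and the
δ-UNIFORM rate bound (`ReferenceShadowing.rate_window`):

* `shadow_window` — for the reference package on `[0,T]` (pressure Sobolev bounds on every `[δ,T]` included) and `τ₁ < T` inside the
  window ceiling, there is ONE number `B` such that for EVERY classical solution `(u,p)` on a slab `[0,τ₂]` in the `L²`-Sobolev
  class and all `0 < δ < τ ≤ min τ₁ τ₂`: if `∫|∇(u−v)(δ)|²_F ≤ D` and `2βe^{2B}D²τ₁ < 1` (`β = 27A⁴/(2ν³)`), then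
  `∫|∇(u−v)(τ)|²_F ≤ e^{B}D/√(1 − 2βe^{2B}D²τ₁)` — a bound that does not see `δ`.

What remains of (R-shadow) after this file: the limit `δ → 0⁺` of the datum defect (`∫|∇(u−v)(δ)|²_F → ∫‖curl(u 0 − m)‖²`, from
`ReferenceFlow.tendsto_enstrophy_sub_nhdsGT` and `H¹`-continuity of `u` at `0`), the time-offset bookkeeping
`|Z(v(ηW_{u0})) − Z(v(ηW_m))|` (`ReferenceFlow.enstrophy_continuousAt`), and the symmetry covariance transporting a route-class flow near
an orbit point `l•R m(l•R⁻¹(·−a))` at time `s` to a slab solution near `m` at time `0`. HONEST FRAMING: continuous dependence between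
two given smooth solutions; (R-shadow), `RigidExit`, `NearMaximiserBoundedAmplification`, `LerayFloorGap`, `ProductionEfficiencyDecay`
(stmt-22866) and Navier–Stokes regularity stay OPEN; no summit statement is proved. [folklore]
-/

-- the problem directory repeats the summit name (`NavierStokesRegularity/NavierStokesRegularity`)
set_option linter.dupNamespace false

noncomputable section

open Set Filter MeasureTheory Topology Function InnerProductSpace
open scoped InnerProductSpace RealInnerProductSpace ENNReal NNReal ContDiff Laplacian
open Literature.Analysis.FluidPDE

namespace Summit.NavierStokesRegularity.NavierStokesRegularity.Theorems

namespace RigidExit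

namespace ReferenceShadowing

section Shadow

variable {ν T : ℝ} {m : EuclideanSpace ℝ (Fin 3) → EuclideanSpace ℝ (Fin 3)}
  {v : ℝ → EuclideanSpace ℝ (Fin 3) → EuclideanSpace ℝ (Fin 3)} {q : ℝ → EuclideanSpace ℝ (Fin 3) → ℝ}

/-- **Uniform `H¹` shadowing of the reference flow on windows `[δ,τ] ⊂ (0,τ₁]`.** Let `(v,q)` be the reference flow through an
admissible `m` with `Z(m) > 0` (Leray package on `[0,T]`, with the Sobolev bounds of `v`, `∂ₜv`, `q` on every `[δ,T]`), `c` a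
one-sided admissible Lu–Doering constant and `τ₁ < T` with `2K·Z(m)²·τ₁ ≤ 1/2`, `K = 27c⁴/(128ν³)`. There is ONE number `B` such
that for every classical forcing-free solution `(u,p)` on `[0,τ₂] × ℝ³` in the `L²`-Sobolev class and all `0 < δ < τ`, `τ ≤ τ₁`,
`τ ≤ τ₂`, `D ≥ ∫|∇(u−v)(δ)|²_F` with `2βe^{2B}D²τ₁ < 1` (`β = 27A⁴/(2ν³)`, `A = agmonConst`):
`∫|∇(u−v)(τ)|²_F ≤ e^{B}D/√(1 − 2βe^{2B}D²τ₁)`. [cite: RobinsonRodrigoSadowskiCUP2016, Thm 9.1, proof (9.2)–(9.5)] -/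
theorem shadow_window (hν : 0 < ν) (hT : 0 < T) (hLH : IsLerayHopfOn T ν 0 m v) (hv0 : v 0 = m)
    (hH1 : IsH1RegularOn (Icc 0 T) v) (hcl : IsClassicalNSSolutionOn (Ioc 0 T) ν 0 v q)
    (hB : ∀ δ : ℝ, 0 < δ → δ ≤ T → HasBoundedSobolevNormsOn (Icc δ T) v)
    (hBt : ∀ δ : ℝ, 0 < δ → δ ≤ T → HasBoundedSobolevNormsOn (Icc δ T) (timeDerivWithin (Ioc 0 T) v))
    (hq : ∀ δ : ℝ, 0 < δ → δ ≤ T → ∀ n : ℕ, ∃ C : ℝ≥0, ∀ t ∈ Icc δ T, ∫⁻ x, ‖iteratedFDeriv ℝ n (q t) x‖ₑ ^ 2 ≤ C)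
    (hm : ContDiff ℝ (⊤ : ℕ∞) m ∧ VectorCalculus.IsDivFree m ∧ (∫⁻ x, ‖iteratedFDeriv ℝ 0 m x‖ₑ ^ 2 < ⊤) ∧
      (∫⁻ x, ‖iteratedFDeriv ℝ 1 m x‖ₑ ^ 2 < ⊤) ∧ (∫⁻ x, ‖iteratedFDeriv ℝ 2 m x‖ₑ ^ 2 < ⊤))
    {c : ℝ}
    (hc : ∀ w : EuclideanSpace ℝ (Fin 3) → EuclideanSpace ℝ (Fin 3), (ContDiff ℝ (⊤ : ℕ∞) w ∧
      VectorCalculus.IsDivFree w ∧ (∫⁻ x, ‖iteratedFDeriv ℝ 0 w x‖ₑ ^ 2 < ⊤) ∧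
      (∫⁻ x, ‖iteratedFDeriv ℝ 1 w x‖ₑ ^ 2 < ⊤) ∧ (∫⁻ x, ‖iteratedFDeriv ℝ 2 w x‖ₑ ^ 2 < ⊤)) →
      (∫ x, ⟪curl w x, fderiv ℝ w x (curl w x)⟫_ℝ) ≤ c * (∫ x, ‖curl w x‖ ^ 2) ^ (3 / 4 : ℝ) *
        (∫ x, frobeniusNormSq (fderiv ℝ (curl w) x)) ^ (3 / 4 : ℝ))
    (hZm : 0 < ∫ x, ‖curl m x‖ ^ 2) {τ₁ : ℝ} (hτ₁T : τ₁ < T)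
    (hwin : 2 * (27 * c ^ 4 / (128 * ν ^ 3)) * (∫ x, ‖curl m x‖ ^ 2) ^ 2 * τ₁ ≤ 1 / 2) :
    ∃ B : ℝ, ∀ (u : ℝ → EuclideanSpace ℝ (Fin 3) → EuclideanSpace ℝ (Fin 3)) (p : ℝ → EuclideanSpace ℝ (Fin 3) → ℝ) (τ₂ : ℝ),
      IsClassicalNSSolutionOn (Icc 0 τ₂) ν 0 u p → HasBoundedSobolevNormsOn (Icc 0 τ₂) u →
      HasBoundedSobolevNormsOn (Icc 0 τ₂) (timeDerivWithin (Icc 0 τ₂) u) →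
      (∀ n : ℕ, ∃ C : ℝ≥0, ∀ t ∈ Icc 0 τ₂, ∫⁻ x, ‖iteratedFDeriv ℝ n (p t) x‖ₑ ^ 2 ≤ C) →
      ∀ δ τ D : ℝ, 0 < δ → δ < τ → τ ≤ τ₁ → τ ≤ τ₂ →
        (∫ x, frobeniusNormSq (fderiv ℝ ((u - v) δ) x)) ≤ D →
        2 * (27 * agmonConst ^ 4 / (2 * ν ^ 3) * Real.exp (2 * B)) * D ^ 2 * τ₁ < 1 →
        (∫ x, frobeniusNormSq (fderiv ℝ ((u - v) τ) x)) ≤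
          Real.exp B * D / Real.sqrt (1 - 2 * (27 * agmonConst ^ 4 / (2 * ν ^ 3) * Real.exp (2 * B)) * D ^ 2 * τ₁) := by
  obtain ⟨B, hBB⟩ := rate_window hν hT hLH hv0 hH1 hcl hB hBt hm hc hZm hτ₁T hwin
  refine ⟨B, fun u p τ₂ hu hU hUt hp δ τ D hδ hδτ hττ₁ hττ₂ hD hsmall => ?_⟩
  have hA := agmonConst_nonneg
  obtain ⟨hlc, hl, hIl⟩ := hBB δ τ hδ hδτ hττ₁
  have hτT : τ < T := hττ₁.trans_lt hτ₁T
  have hδT : δ < T := hδτ.trans hτT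
  have hsubT : Icc δ τ ⊆ Ioc 0 T := fun s hs => ⟨hδ.trans_le hs.1, hs.2.trans hτT.le⟩
  have hsub₂ : Icc δ τ ⊆ Icc 0 τ₂ := fun s hs => ⟨hδ.le.trans hs.1, hs.2.trans hττ₂⟩
  have hUδ : UniqueDiffOn ℝ (Icc δ τ) := uniqueDiffOn_Icc hδτ
  -- restrictions of the two solutions and their classes to `[δ, τ]`
  have hv' : IsClassicalNSSolutionOn (Icc δ τ) ν 0 v q := hcl.mono hsubT hUδ
  have hu' : IsClassicalNSSolutionOn (Icc δ τ) ν 0 u p := hu.mono hsub₂ hUδ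
  have hV' : HasBoundedSobolevNormsOn (Icc δ τ) v := (hB δ hδ hδT.le).mono (Icc_subset_Icc_right hτT.le)
  have hU' : HasBoundedSobolevNormsOn (Icc δ τ) u := hU.mono hsub₂
  have hVt' : HasBoundedSobolevNormsOn (Icc δ τ) (timeDerivWithin (Icc δ τ) v) := by
    intro n
    obtain ⟨C, hC⟩ := hBt δ hδ hδT.le n
    refine ⟨C, fun t ht => ?_⟩
    have heq : timeDerivWithin (Icc δ τ) v t = timeDerivWithin (Ioc 0 T) v t :=
      funext fun x => hcl.smooth_velocity.timeDerivWithin_eq_of_subset hsubT hUδ ht x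
    rw [heq]
    exact hC t ⟨ht.1, ht.2.trans hτT.le⟩
  have hUt' : HasBoundedSobolevNormsOn (Icc δ τ) (timeDerivWithin (Icc δ τ) u) := by
    intro n
    obtain ⟨C, hC⟩ := hUt n
    refine ⟨C, fun t ht => ?_⟩
    have heq : timeDerivWithin (Icc δ τ) u t = timeDerivWithin (Icc 0 τ₂) u t :=
      funext fun x => hu.smooth_velocity.timeDerivWithin_eq_of_subset hsub₂ hUδ ht x
    rw [heq]
    exact hC t (hsub₂ ht)
  have hq' : ∀ n : ℕ, ∃ C : ℝ≥0, ∀ t ∈ Icc δ τ, ∫⁻ x, ‖iteratedFDeriv ℝ n (q t) x‖ₑ ^ 2 ≤ C := fun n =>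
    (hq δ hδ hδT.le n).imp fun C hC t ht => hC t ⟨ht.1, ht.2.trans hτT.le⟩
  have hp' : ∀ n : ℕ, ∃ C : ℝ≥0, ∀ t ∈ Icc δ τ, ∫⁻ x, ‖iteratedFDeriv ℝ n (p t) x‖ₑ ^ 2 ≤ C := fun n =>
    (hp n).imp fun C hC t ht => hC t (hsub₂ ht)
  -- nonnegativity and the smallness on `[δ, τ]`
  have hX0 : 0 ≤ ∫ x, frobeniusNormSq (fderiv ℝ ((u - v) δ) x) := integral_nonneg fun _ => frobeniusNormSq_nonneg _
  have hD0 : 0 ≤ D := hX0.trans hD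
  have hcoef : 0 ≤ 2 * (27 * agmonConst ^ 4 / (2 * ν ^ 3) * Real.exp (2 * B)) * D ^ 2 := by positivity
  have hmono : 2 * (27 * agmonConst ^ 4 / (2 * ν ^ 3) * Real.exp (2 * B)) * D ^ 2 * (τ - δ) ≤
      2 * (27 * agmonConst ^ 4 / (2 * ν ^ 3) * Real.exp (2 * B)) * D ^ 2 * τ₁ :=
    mul_le_mul_of_nonneg_left (by linarith) hcoef
  have hsmall' : 2 * (27 * agmonConst ^ 4 / (2 * ν ^ 3) * Real.exp (2 * B)) * D ^ 2 * (τ - δ) < 1 :=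
    hmono.trans_lt hsmall
  have key := robustness_window_of_le hν hδτ hu' hv' hV' hVt' hq' hU' hUt' hp' hlc hl hD hIl hsmall'
    (t := τ) ⟨hδτ.le, le_rfl⟩
  refine key.trans (div_le_div₀ (by positivity) le_rfl (Real.sqrt_pos.2 (by linarith)) ?_)
  exact Real.sqrt_le_sqrt (by linarith)

end Shadow

end ReferenceShadowing

end RigidExit

end Summit.NavierStokesRegularity.NavierStokesRegularity.Theorems

end
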